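import Summits.Schanuel.Schanuel.Theorems.ZilberEacGraphLinearComplete
import Summits.Schanuel.Schanuel.Theorems.ZilberEacGraphBinomialSurface
import HarnessLib

/-!
# The equimodular class, XXI: the BINOMIAL class over polynomial graphs is completely decided; the
# literal residual has two distinct positive `y₀`-degrees (or a constant fibre)

HONEST FRAMING.  Cell `pub-schanuel` (Zilber's Exponential-Algebraic Closedness, case ladder;
host summit Schanuel), seat 2, gen 23.  File XVII decided the `y₀`-linear class from support data;
file XIX decided binomial fibres `A(x₀)y₀^r + B(x₀) = 0` given as such.  Here the two are combined:
* **`unprojectedDense_graph_binomialFibre`**: `deg p ≥ 2`, `P ∈ ℂ[x₀, y₀]` irreducible whose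
  monomials have `y₀`-degree `0` or `r` (`r ≥ 1`), both occurring, and some monomial of positive
  `x₀`-degree ⟹ `{x₁ = p(x₀), P(x₀, y₀) = 0}` has Zariski-dense exponential points (rows
  `A = [y₀^r]P`, `B = [y₀⁰]P`; unequal degrees ⟹ gens 17–18 via the residual theorem; equal degrees
  ⟹ coprime by irreducibility ⟹ file XIX);
* **`mmCase_graphBase_residual_twoPositiveDegrees`**: a surface of Mantova–Masser's case over a
  polynomial graph of degree `≥ 2` WITHOUT Zariski-dense exponential points has a fibre curve `P₂`
  with two monomials of DISTINCT POSITIVE `y₀`-degrees — or `P₂ ∈ ℂ[y₀]` (constant fibre, not free).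
Complete classes of instances of an OPEN question (PLMS 2024 §1 p. 5); EC(3,2) OPEN; NOT Schanuel's
conjecture (neither used nor implied; EAC ⇏ SC).
-/

noncomputable section

open Filter Topology Set Complex MvPolynomial
open Literature.NumberTheory.Transcendental Literature.ModelTheory.Zilber
open Literature.ModelTheory.ExponentialFields

set_option linter.dupNamespace false

namespace Summit.Schanuel.Schanuel.Theorems

/-! ## Part A. Rows of a binomial-support polynomial -/

section Rows

variable (P : MvPolynomial (Fin 2) ℂ) {r : ℕ}

/-- **Evaluation through the two rows** when every monomial has `y₀`-degree `0` or `r ≥ 1`: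
`P(x, y) = A(x)·y^r + B(x)`. [folklore] -/
theorem eval_eq_rows_of_binomial (hr : 1 ≤ r) (hsupp : ∀ v ∈ P.support, v 1 = 0 ∨ v 1 = r) (x y : ℂ) :
    MvPolynomial.eval ![x, y] P =
      (∑ v ∈ P.support.filter (fun v : Fin 2 →₀ ℕ => v 1 = r),
          Polynomial.monomial (v 0) (P.coeff v)).eval x * y ^ r +
        (∑ v ∈ P.support.filter (fun v : Fin 2 →₀ ℕ => v 1 = 0),
          Polynomial.monomial (v 0) (P.coeff v)).eval x := by
  classical
  rw [MvPolynomial.eval_eq', Polynomial.eval_finsetSum, Polynomial.eval_finsetSum, Finset.sum_mul,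
    ← Finset.sum_filter_add_sum_filter_not P.support (fun v : Fin 2 →₀ ℕ => v 1 = r)]
  congr 1
  · refine Finset.sum_congr rfl fun v hv => ?_
    obtain ⟨-, hv1⟩ := Finset.mem_filter.1 hv
    rw [Fin.prod_univ_two, Polynomial.eval_monomial]
    simp only [Matrix.cons_val_zero, Matrix.cons_val_one, hv1]
    ring
  · have hfilt : P.support.filter (fun v : Fin 2 →₀ ℕ => ¬ v 1 = r) =
        P.support.filter (fun v : Fin 2 →₀ ℕ => v 1 = 0) := by
      refine Finset.filter_congr fun v hv => ?_
      rcases hsupp v hv with h | h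
      · simp [h]; omega
      · simp [h]; omega
    rw [hfilt]
    refine Finset.sum_congr rfl fun v hv => ?_
    obtain ⟨-, hv1⟩ := Finset.mem_filter.1 hv
    rw [Fin.prod_univ_two, Polynomial.eval_monomial]
    simp [hv1]

/-- **The MvPolynomial identity `P = A(X₀)·X₁^r + B(X₀)`** for binomial support. [folklore] -/
theorem eq_rows_of_binomial (hr : 1 ≤ r) (hsupp : ∀ v ∈ P.support, v 1 = 0 ∨ v 1 = r) :
    P = Polynomial.aeval (X 0 : MvPolynomial (Fin 2) ℂ)
          (∑ v ∈ P.support.filter (fun v : Fin 2 →₀ ℕ => v 1 = r),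
            Polynomial.monomial (v 0) (P.coeff v)) * X 1 ^ r +
        Polynomial.aeval (X 0 : MvPolynomial (Fin 2) ℂ)
          (∑ v ∈ P.support.filter (fun v : Fin 2 →₀ ℕ => v 1 = 0),
            Polynomial.monomial (v 0) (P.coeff v)) := by
  refine MvPolynomial.funext fun xs => ?_
  have hxs : xs = ![xs 0, xs 1] := by
    funext i; fin_cases i <;> rfl
  rw [map_add, map_mul, map_pow, MvPolynomial.eval_X, mvEval_aeval_X, mvEval_aeval_X]
  conv_lhs => rw [hxs, eval_eq_rows_of_binomial P hr hsupp]

/-- **Coprimality of the rows from irreducibility** (binomial version): if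
`P = A(x₀) y₀^r + B(x₀)` is irreducible, `r ≥ 1`, `A ≠ 0`, then `A, B` are coprime. [folklore] -/
theorem isCoprime_rows_of_irreducible_binomial {A B : Polynomial ℂ} (hr : 1 ≤ r) (hA : A ≠ 0)
    (hPAB : P = Polynomial.aeval (X 0 : MvPolynomial (Fin 2) ℂ) A * X 1 ^ r +
      Polynomial.aeval (X 0 : MvPolynomial (Fin 2) ℂ) B)
    (hirr : Irreducible P) : IsCoprime A B := by
  rw [Polynomial.isCoprime_iff_aeval_ne_zero_of_isAlgClosed ℂ ℂ]
  intro t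
  by_contra hboth
  push Not at hboth
  obtain ⟨hAt, hBt⟩ := hboth
  rw [Polynomial.coe_aeval_eq_eval] at hAt hBt
  obtain ⟨A₁, hA₁⟩ := (Polynomial.dvd_iff_isRoot.2 hAt : Polynomial.X - Polynomial.C t ∣ A)
  obtain ⟨B₁, hB₁⟩ := (Polynomial.dvd_iff_isRoot.2 hBt : Polynomial.X - Polynomial.C t ∣ B)
  set L : MvPolynomial (Fin 2) ℂ := X 0 - MvPolynomial.C t with hL
  set Q : MvPolynomial (Fin 2) ℂ := Polynomial.aeval (X 0 : MvPolynomial (Fin 2) ℂ) A₁ * X 1 ^ r +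
    Polynomial.aeval (X 0 : MvPolynomial (Fin 2) ℂ) B₁ with hQ
  have hfac : P = L * Q := by
    rw [hPAB, hA₁, hB₁, hQ, hL, map_mul, map_mul, map_sub, Polynomial.aeval_X, Polynomial.aeval_C,
      MvPolynomial.algebraMap_eq]
    ring
  have hA₁0 : A₁ ≠ 0 := by
    rintro rfl; rw [mul_zero] at hA₁; exact hA hA₁
  have hLnu : ¬ IsUnit L := by
    intro hu
    have h := (hu.map (MvPolynomial.eval ![t, 0])).ne_zero
    apply h
    simp [hL]
  have hQnu : ¬ IsUnit Q := by
    intro hu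
    obtain ⟨s, hs⟩ : ∃ s : ℂ, A₁.eval s ≠ 0 := by
      by_contra h
      push Not at h
      exact hA₁0 (Polynomial.funext fun s => by simpa using h s)
    obtain ⟨y, hy⟩ := IsAlgClosed.exists_pow_nat_eq (-B₁.eval s / A₁.eval s) (by omega : 0 < r)
    have h := (hu.map (MvPolynomial.eval ![s, y])).ne_zero
    apply h
    rw [hQ, map_add, map_mul, map_pow, MvPolynomial.eval_X, mvEval_aeval_X, mvEval_aeval_X]
    simp only [Matrix.cons_val_zero, Matrix.cons_val_one]
    rw [hy]
    field_simp
    ring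
  rcases hirr.isUnit_or_isUnit hfac with h | h
  · exact hLnu h
  · exact hQnu h

end Rows

/-! ## Part B. The binomial class over polynomial graphs is dense -/

section Complete

variable (p : Polynomial ℂ) {P : MvPolynomial (Fin 2) ℂ}

/-- **THE BINOMIAL CLASS OVER POLYNOMIAL GRAPHS OF DEGREE `≥ 2` IS DENSE.**  `P ∈ ℂ[x₀, y₀]`
irreducible with all monomials of `y₀`-degree `0` or `r` (`r ≥ 1`), both degrees present, and some
monomial of positive `x₀`-degree.  Then `{x₁ = p(x₀), P(x₀, y₀) = 0}` has Zariski-dense exponential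
points — whatever `p` of degree `≥ 2`.
[cite: MantovaMasser2023, §1 Further remarks, p. 5 (the question, open in general)] (new) -/
theorem unprojectedDense_graph_binomialFibre (hd : 2 ≤ p.natDegree) (hirr : Irreducible P) {r : ℕ}
    (hr : 1 ≤ r) (hsupp : ∀ v ∈ P.support, v 1 = 0 ∨ v 1 = r)
    (h0 : ∃ v ∈ P.support, v 1 = 0) (hR : ∃ v ∈ P.support, v 1 = r)
    (hx : ∃ v ∈ P.support, 0 < v 0) :
    UnprojectedDense {w : Fin 2 ⊕ Fin 2 → ℂ | w (Sum.inl 1) = p.eval (w (Sum.inl 0)) ∧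
      MvPolynomial.eval ![w (Sum.inl 0), w (Sum.inr 0)] P = 0} := by
  classical
  have h1 : ∃ v ∈ P.support, ∃ v' ∈ P.support, v 1 ≠ v' 1 := by
    obtain ⟨v, hv, hv0⟩ := h0
    obtain ⟨v', hv', hv'r⟩ := hR
    exact ⟨v, hv, v', hv', by omega⟩
  by_contra hnot
  obtain ⟨-, hrow, -⟩ := fibreCurveSurface_residual_of_not_unprojectedDense p hd hirr h1 hnot
  -- the maximal `x₀`-degree `N₀ ≥ 1`
  have hsne : P.support.Nonempty := MvPolynomial.support_nonempty.2 hirr.ne_zero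
  obtain ⟨v₀, hv₀, hv₀max⟩ := Finset.exists_max_image P.support (fun v : Fin 2 →₀ ℕ => v 0) hsne
  set N₀ : ℕ := v₀ 0 with hN₀
  have hN₀max : ∀ v ∈ P.support, v 0 ≤ N₀ := fun v hv => hv₀max v hv
  have hN₀pos : 1 ≤ N₀ := by
    obtain ⟨v, hv, hvpos⟩ := hx
    exact le_trans hvpos (hN₀max v hv)
  obtain ⟨⟨vR, hvR, hvR0, hvRmax⟩, ⟨vL, hvL, hvL0, hvLmin⟩⟩ := hrow v₀ hv₀ hN₀max
  -- the extreme `y₀`-degrees are `r` and `0`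
  have hvR1 : vR 1 = r := by
    rcases hsupp vR hvR with h | h
    · exfalso
      obtain ⟨v', hv', hv'r⟩ := hR
      have := hvRmax v' hv'
      omega
    · exact h
  have hvL1 : vL 1 = 0 := by
    rcases hsupp vL hvL with h | h
    · exact h
    · exfalso
      obtain ⟨v, hv, hv0⟩ := h0
      have := hvLmin v hv
      omega
  -- the rows
  set A : Polynomial ℂ := ∑ v ∈ P.support.filter (fun v : Fin 2 →₀ ℕ => v 1 = r),
    Polynomial.monomial (v 0) (P.coeff v) with hA
  set B : Polynomial ℂ := ∑ v ∈ P.support.filter (fun v : Fin 2 →₀ ℕ => v 1 = 0),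
    Polynomial.monomial (v 0) (P.coeff v) with hB
  have hP : ∀ x y : ℂ, MvPolynomial.eval ![x, y] P = A.eval x * y ^ r + B.eval x :=
    eval_eq_rows_of_binomial P hr hsupp
  obtain ⟨hAdeg, hAlc⟩ : A.natDegree = N₀ ∧
      A.leadingCoeff = P.coeff (Finsupp.single 0 N₀ + Finsupp.single 1 r) :=
    natDegree_row_eq P hN₀max hvR hvR0 hvR1
  obtain ⟨hBdeg, hBlc⟩ : B.natDegree = N₀ ∧
      B.leadingCoeff = P.coeff (Finsupp.single 0 N₀ + Finsupp.single 1 0) :=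
    natDegree_row_eq P hN₀max hvL hvL0 hvL1
  have hA0 : A ≠ 0 :=
    Polynomial.ne_zero_of_natDegree_gt (show 0 < A.natDegree by rw [hAdeg]; exact hN₀pos)
  have hlcA : A.leadingCoeff ≠ 0 := Polynomial.leadingCoeff_ne_zero.2 hA0
  have hlcB : B.leadingCoeff ≠ 0 := by
    rw [hBlc]
    have : vL = Finsupp.single 0 N₀ + Finsupp.single 1 0 := by
      ext i; fin_cases i <;> simp [hvL0, hvL1, hN₀]
    rw [← this]
    exact MvPolynomial.mem_support_iff.1 hvL
  have hcop : IsCoprime A B :=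
    isCoprime_rows_of_irreducible_binomial P hr hA0 (eq_rows_of_binomial P hr hsupp) hirr
  set θ : ℂ := -B.leadingCoeff / A.leadingCoeff with hθ
  have hθ0 : θ ≠ 0 := div_ne_zero (neg_ne_zero.2 hlcB) hlcA
  set τ' : ℂ := Complex.log θ with hτ'
  have hlc : B.leadingCoeff = -Complex.exp τ' * A.leadingCoeff := by
    rw [hτ', Complex.exp_log hθ0, hθ]
    field_simp
  exact hnot (unprojectedDense_graphBinomialSurface A B hr hP hirr (by rw [hAdeg]; exact hN₀pos)
    (by rw [hAdeg, hBdeg]) hcop p hd τ' hlc)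

end Complete

/-! ## Part C. The literal residual: two distinct positive `y₀`-degrees -/

section Residual

variable (p : Polynomial ℂ)

/-- **The residual theorem over polynomial graphs of degree `≥ 2`, binomial sharpening.**  A surface
of Mantova–Masser's case over `x₁ = p(x₀)` without Zariski-dense exponential points is
`{x₁ = p(x₀), P₂(x₀, y₀) = 0}` with `P₂` irreducible satisfying gen 18's equimodular conditions and:
`P₂` has two monomials of DISTINCT POSITIVE `y₀`-degrees, or `P₂ ∈ ℂ[y₀]` (constant fibre).
[cite: MantovaMasser2023, §1 Further remarks, p. 5 (the question, open in general)] (new) -/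
theorem mmCase_graphBase_residual_twoPositiveDegrees (hd : 2 ≤ p.natDegree)
    {W : Set (Fin 2 ⊕ Fin 2 → ℂ)} (hmm : MMCaseDimPiOneFree W)
    (hbase : zeroLocus ℂ (vanishingIdeal ℂ (projAdd '' (W ∩ torusLocus ℂ 2))) =
      {x : Fin 2 → ℂ | x 1 = p.eval (x 0)})
    (hnot : ¬ UnprojectedDense W) :
    ∃ P₂ : MvPolynomial (Fin 2) ℂ, Irreducible P₂ ∧
      (∃ v ∈ P₂.support, ∃ v' ∈ P₂.support, v 1 ≠ v' 1) ∧
      W = {w : Fin 2 ⊕ Fin 2 → ℂ | w (Sum.inl 1) = p.eval (w (Sum.inl 0)) ∧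
        MvPolynomial.eval ![w (Sum.inl 0), w (Sum.inr 0)] P₂ = 0} ∧
      (p.leadingCoeff * I ^ p.natDegree).re = 0 ∧
      (∀ v₀ ∈ P₂.support, (∀ v ∈ P₂.support, v 0 ≤ v₀ 0) →
        (∃ vR ∈ P₂.support, vR 0 = v₀ 0 ∧ ∀ u ∈ P₂.support, u 1 ≤ vR 1) ∧
        (∃ vL ∈ P₂.support, vL 0 = v₀ 0 ∧ ∀ u ∈ P₂.support, vL 1 ≤ u 1)) ∧
      (∀ N₀ : ℕ, (∀ v ∈ P₂.support, v 0 ≤ N₀) → ∀ va ∈ P₂.support, ∀ vc ∈ P₂.support,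
        va 0 = N₀ → vc 0 = N₀ → va 1 ≠ vc 1 → ∀ θ : ℂ, θ ≠ 0 →
        (∑ v ∈ P₂.support.filter (fun v : Fin 2 →₀ ℕ => v 0 = N₀),
          Polynomial.C (P₂.coeff v) * Polynomial.X ^ (v 1)).eval θ = 0 →
        (p.natDegree : ℝ) * (p.leadingCoeff * I ^ (p.natDegree - 1)).re * Real.log ‖θ‖ +
          (p.coeff (p.natDegree - 1) * I ^ (p.natDegree - 1)).re = 0) ∧
      ((∃ v ∈ P₂.support, ∃ v' ∈ P₂.support, 0 < v 1 ∧ 0 < v' 1 ∧ v 1 ≠ v' 1) ∨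
        (∀ v ∈ P₂.support, v 0 = 0)) := by
  classical
  obtain ⟨P₂, hirr₂, h1, hW₂, hre, hrow, hroot⟩ := mmCase_graphBase_residual p hd hmm hbase hnot
  refine ⟨P₂, hirr₂, h1, hW₂, hre, hrow, hroot, ?_⟩
  by_contra hneither
  push Not at hneither
  obtain ⟨hone, ⟨vx, hvx, hvx0⟩⟩ := hneither
  -- all positive `y₀`-degrees coincide (`hone`); call the common value `r`
  obtain ⟨va, hva, vb, hvb, hab⟩ := h1
  -- a monomial of positive `y₀`-degree exists (the two degrees differ, so one is positive)
  obtain ⟨r, hrpos, hrmem⟩ : ∃ r : ℕ, 0 < r ∧ ∃ v ∈ P₂.support, v 1 = r := by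
    rcases Nat.eq_zero_or_pos (va 1) with h | h
    · exact ⟨vb 1, by omega, vb, hvb, rfl⟩
    · exact ⟨va 1, h, va, hva, rfl⟩
  obtain ⟨vr, hvr, hvr1⟩ := hrmem
  have hsupp : ∀ v ∈ P₂.support, v 1 = 0 ∨ v 1 = r := by
    intro v hv
    rcases Nat.eq_zero_or_pos (v 1) with h | h
    · exact Or.inl h
    · right
      by_contra hne
      exact absurd (hone v hv vr hvr h (by omega)) (by omega)
  have h0 : ∃ v ∈ P₂.support, v 1 = 0 := by
    rcases hsupp va hva with h | h
    · exact ⟨va, hva, h⟩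
    · rcases hsupp vb hvb with h' | h'
      · exact ⟨vb, hvb, h'⟩
      · exact absurd (h.trans h'.symm) hab
  apply hnot
  rw [hW₂]
  exact unprojectedDense_graph_binomialFibre p hd hirr₂ hrpos hsupp h0 ⟨vr, hvr, hvr1⟩
    ⟨vx, hvx, Nat.pos_of_ne_zero hvx0⟩

end Residual

end Summit.Schanuel.Schanuel.Theorems
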